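import Summits.AtomisticToContinuum.FouriersLaw.Theorems.PhononMeanFreePathIncoherentBoundedDissipation
import Summits.AtomisticToContinuum.FouriersLaw.Theorems.PhononMeanFreePathIncoherentBoundedFixedN
import Summits.AtomisticToContinuum.FouriersLaw.Theorems.JunctionLocalitySuperadditiveResistanceStubBypassBoundAux2

/-!
# `PhononMeanFreePath.IncoherentBounded` — the `N`-uniform `L²(dt)` bound on the power covariance `C_N`

Helper file for item `stmt-AtomisticToContinuum-11815` (support `IncoherentBounded`, route `PhononMeanFreePath`,
sub-problem `FouriersLaw`). The item's sequence is `a_N = N (γ²/T²) ∫_{t>0} (C_N(t) - 2 r_N(t)²) dt`, where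
`C_N(t) = ∫ p₀² (K_t p_N²) dμ₀ - (∫ p₀² dμ₀)(∫ K_t p_N² dμ₀) = ∫ (p₀² - T) K_t(p_N² - T) dμ₀` is the equilibrium
power–power covariance of the `(N+1)`-site pinned anharmonic chain whose time integral is the Green–Kubo
conductance. From the dissipation inequality of the equilibrium semigroup (file `…Dissipation`) and two Gaussian
integrations by parts in `p₀` (`abs_integral_mul_sq_sub_gibbsMeasure_le`) this file proves

* `ofReal_sq_integral_kin_mul_forecast_le` — `(∫ (p_j² - T) K_s F dμ_T)² ≤ T³ ∫ (∂_{p_j} K_s F)² dμ_T`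
  (`F ∈ C_c`, `s > 0`);
* `lintegral_sq_integral_kin_mul_forecast_le` — `∫_{s>0} (∫ (p_0² - T) K_s F dμ_T)² ds ≤ (T²/(2γ)) ∫ F² dμ_T`;
* `lintegral_CN_sq_le`, `integral_CN_sq_le` — truncation, dominated convergence and Fatou:

    `∫_{t>0} C_N(t)² dt ≤ T⁴/γ` for every `N`.

This is `N`-uniform but `O(1)` and in `L²(dt)`; the item needs the signed `L¹(dt)` statement
`∫_{t>0} C_N = O(1/N)` (conductance upper bound, the open upper half of Fourier's law). No definitions.
-/

noncomputable section

open MeasureTheory ProbabilityTheory Filter Topology Set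
open scoped NNReal ENNReal ContDiff
open Literature.MathematicalPhysics.KineticTheory.HeatConduction
open Literature.MathematicalPhysics.KineticTheory Literature.Probability.Process OscillatorChain

namespace Summit.AtomisticToContinuum.FouriersLaw.Theorems.IncoherentBounded

variable {N : ℕ}

/-! ## 8. The `N`-uniform `L²(dt)` bound on the power covariance `C_N` -/

section KinPointwise

open Summit.AtomisticToContinuum.FouriersLaw.Theorems.SubdiffusiveBondHeat
open Summit.AtomisticToContinuum.FouriersLaw.Cruxes.SuperadditiveResistance.FloatingProbeBypassLaplacian

variable {ω₂ lam β γ : ℝ} (hω : 0 < ω₂) (hl : 0 ≤ lam) (hβ : 0 < β) (hγ : 0 < γ)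
  (hN : 0 < N) {T : ℝ} (hT : 0 < T)
include hω hl hβ hγ hN hT

omit hN in
/-- **The pointwise bound for the kinetic source.** For `F ∈ C_c(Ω)`, `s > 0`, `u_s = K_s F` and any momentum
index `j`: `(∫ (p_j² - T) u_s dμ_T)² ≤ T³ ∫ (∂_{p_j} u_s)² dμ_T` (lower Lebesgue integral on the right; two
Gaussian integrations by parts `∫ g (p_j² - T) dμ_T = T ∫ ∂_{p_j} g · p_j dμ_T`, Cauchy–Schwarz and equipartition,
`abs_integral_mul_sq_sub_gibbsMeasure_le`). [folklore] -/
theorem ofReal_sq_integral_kin_mul_forecast_le (hN' : 0 < N) (j : Fin N) {F : PhaseSpace N → ℝ}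
    (hFc : Continuous F) (hFs : HasCompactSupport F) {s : ℝ} (hs : 0 < s) :
    ENNReal.ofReal ((∫ x, (x.2 j ^ 2 - T) *
        (∫ y, F y ∂((pinnedChain ω₂ lam β γ).transitionKernel N T T s.toNNReal x))
          ∂((pinnedChain ω₂ lam β γ).gibbsMeasure N T)) ^ 2) ≤
      ENNReal.ofReal (T ^ 3) * ∫⁻ x, ENNReal.ofReal (partialP j
        (fun z => ∫ y, F y ∂((pinnedChain ω₂ lam β γ).transitionKernel N T T s.toNNReal z)) x ^ 2)
          ∂((pinnedChain ω₂ lam β γ).gibbsMeasure N T) := by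
  set P := pinnedChain ω₂ lam β γ with hP
  set μ := P.gibbsMeasure N T with hμ
  haveI : IsProbabilityMeasure μ := pinnedChain_isProbabilityMeasure_gibbsMeasure hω hl hβ.le γ N hT
  haveI hMK : ∀ t, IsMarkovKernel (P.transitionKernel N T T t) := fun t =>
    pinnedChain_isMarkovKernel_transitionKernel hω hl hβ.le hγ.le N T T t
  set u : PhaseSpace N → ℝ := fun z => ∫ y, F y ∂(P.transitionKernel N T T s.toNNReal z) with hu
  have hu2 : ContDiff ℝ 2 u := contDiff_forecast hω hl hγ hN' hβ.le hT hT.le hFc hFs hs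
  have hud : Differentiable ℝ u := hu2.differentiable two_ne_zero
  obtain ⟨M, hM⟩ : ∃ M, ∀ x, ‖F x‖ ≤ M := hFc.bounded_above_of_compact_support hFs
  have hM' : ∀ z, |F z| ≤ M := fun z => by rw [← Real.norm_eq_abs]; exact hM z
  have hub : ∀ x, |u x| ≤ M := fun x =>
    (integrable_and_abs_integral_le (ν := P.transitionKernel N T T s.toNNReal x) hFc.measurable hM').2
  have huL2 : MemLp u 2 μ :=
    memLp_of_bounded (a := -M) (b := M) (Eventually.of_forall fun x => abs_le.1 (hub x))
      hud.continuous.aestronglyMeasurable 2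
  have hduc : Continuous (partialP j u) := continuous_partialP hu2 two_ne_zero j
  show ENNReal.ofReal ((∫ x, (x.2 j ^ 2 - T) * u x ∂μ) ^ 2) ≤
    ENNReal.ofReal (T ^ 3) * ∫⁻ x, ENNReal.ofReal (partialP j u x ^ 2) ∂μ
  by_cases hfin : ∫⁻ x, ENNReal.ofReal (partialP j u x ^ 2) ∂μ = ⊤
  · rw [hfin, ENNReal.mul_top (ENNReal.ofReal_pos.2 (by positivity)).ne']
    exact le_top
  have hI2 : Integrable (fun x => partialP j u x ^ 2) μ :=
    ⟨(hduc.pow 2).aestronglyMeasurable,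
      (hasFiniteIntegral_iff_ofReal (ae_of_all _ fun x => sq_nonneg _)).2 (lt_top_iff_ne_top.2 hfin)⟩
  have hdu2 : MemLp (partialP j u) 2 μ := (memLp_two_iff_integrable_sq hduc.aestronglyMeasurable).2 hI2
  have hcs := abs_integral_mul_sq_sub_gibbsMeasure_le hω hl hβ.le γ N hT j hud huL2 hdu2
  have hcomm : ∫ x, (x.2 j ^ 2 - T) * u x ∂μ = ∫ x, u x * (x.2 j ^ 2 - T) ∂μ :=
    integral_congr_ae (ae_of_all _ fun x => mul_comm _ _)
  have hI0 : 0 ≤ ∫ x, partialP j u x ^ 2 ∂μ := integral_nonneg fun x => sq_nonneg _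
  have hsq : (∫ x, (x.2 j ^ 2 - T) * u x ∂μ) ^ 2 ≤ T ^ 3 * ∫ x, partialP j u x ^ 2 ∂μ := by
    rw [hcomm, ← sq_abs]
    calc |∫ x, u x * (x.2 j ^ 2 - T) ∂μ| ^ 2
        ≤ (T * Real.sqrt T * Real.sqrt (∫ x, partialP j u x ^ 2 ∂μ)) ^ 2 :=
          pow_le_pow_left₀ (abs_nonneg _) hcs 2
      _ = T ^ 3 * ∫ x, partialP j u x ^ 2 ∂μ := by
          rw [mul_pow, mul_pow, Real.sq_sqrt hT.le, Real.sq_sqrt hI0]; ring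
  rw [← ofReal_integral_eq_lintegral_ofReal hI2 (ae_of_all _ fun x => sq_nonneg _),
    ← ENNReal.ofReal_mul (by positivity)]
  exact ENNReal.ofReal_le_ofReal hsq

/-- **The integrated bound for the kinetic source and a compactly supported observable.** For `F ∈ C_c(Ω)`:
`∫_{s>0} (∫ (p_0² - T) K_s F dμ_T)² ds ≤ (T²/(2γ)) ∫ F² dμ_T` (pointwise bound, `2γT (∂_{p_0} u)² ≤ 2Γ(u)`,
dissipation inequality). [folklore] -/
theorem lintegral_sq_integral_kin_mul_forecast_le {F : PhaseSpace N → ℝ} (hFc : Continuous F)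
    (hFs : HasCompactSupport F) :
    ∫⁻ s in Ioi (0 : ℝ), ENNReal.ofReal ((∫ x, (x.2 ⟨0, hN⟩ ^ 2 - T) *
        (∫ y, F y ∂((pinnedChain ω₂ lam β γ).transitionKernel N T T s.toNNReal x))
          ∂((pinnedChain ω₂ lam β γ).gibbsMeasure N T)) ^ 2) ≤
      ENNReal.ofReal (T ^ 2 / (2 * γ) * ∫ x, F x ^ 2 ∂((pinnedChain ω₂ lam β γ).gibbsMeasure N T)) := by
  set P := pinnedChain ω₂ lam β γ with hP
  set μ := P.gibbsMeasure N T with hμ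
  set j₀ : Fin N := ⟨0, hN⟩ with hj₀
  set U : ℝ → PhaseSpace N → ℝ := fun s z => ∫ y, F y ∂(P.transitionKernel N T T s.toNNReal z) with hU
  have hD := dissipation_lintegral_le' hω hl hβ hγ hN hT hFc hFs
  set X : ℝ≥0∞ := ∫⁻ s in Ioi (0 : ℝ), ∫⁻ x, ENNReal.ofReal (partialP j₀ (U s) x ^ 2) ∂μ with hX
  have hw : T ≤ (if j₀.val = 0 then T else 0) + (if j₀.val = N - 1 then T else 0) := by
    rw [if_pos (show j₀.val = 0 from rfl)]
    split_ifs <;> linarith [hT.le]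
  have hpt : ∀ s x, ENNReal.ofReal (2 * γ * T) * ENNReal.ofReal (partialP j₀ (U s) x ^ 2) ≤
      ENNReal.ofReal (2 * (γ * ∑ i : Fin N,
        ((if i.val = 0 then T else 0) + (if i.val = N - 1 then T else 0)) * partialP i (U s) x ^ 2)) := by
    intro s x
    rw [← ENNReal.ofReal_mul (by positivity)]
    refine ENNReal.ofReal_le_ofReal ?_
    have hsum : ((if j₀.val = 0 then T else 0) + (if j₀.val = N - 1 then T else 0)) * partialP j₀ (U s) x ^ 2 ≤
        ∑ i : Fin N, ((if i.val = 0 then T else 0) + (if i.val = N - 1 then T else 0)) * partialP i (U s) x ^ 2 :=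
      Finset.single_le_sum (f := fun i : Fin N =>
        ((if i.val = 0 then T else 0) + (if i.val = N - 1 then T else 0)) * partialP i (U s) x ^ 2)
        (fun i _ => mul_nonneg (add_nonneg (by split_ifs <;> linarith [hT.le]) (by split_ifs <;> linarith [hT.le]))
          (sq_nonneg _)) (Finset.mem_univ j₀)
    have h1 : T * partialP j₀ (U s) x ^ 2 ≤
        ((if j₀.val = 0 then T else 0) + (if j₀.val = N - 1 then T else 0)) * partialP j₀ (U s) x ^ 2 :=
      mul_le_mul_of_nonneg_right hw (sq_nonneg _)
    nlinarith [hγ.le]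
  have hkey : ENNReal.ofReal (2 * γ * T) * X ≤ ENNReal.ofReal (∫ x, F x ^ 2 ∂μ) := by
    refine le_trans ?_ hD
    rw [hX, ← lintegral_const_mul' _ _ ENNReal.ofReal_ne_top]
    refine lintegral_mono fun s => ?_
    rw [← lintegral_const_mul' _ _ ENNReal.ofReal_ne_top]
    exact lintegral_mono fun x => hpt s x
  have hpw : ∫⁻ s in Ioi (0 : ℝ), ENNReal.ofReal ((∫ x, (x.2 j₀ ^ 2 - T) * U s x ∂μ) ^ 2) ≤
      ENNReal.ofReal (T ^ 3) * X := by
    rw [hX, ← lintegral_const_mul' _ _ ENNReal.ofReal_ne_top]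
    refine setLIntegral_mono' measurableSet_Ioi fun s hs => ?_
    exact ofReal_sq_integral_kin_mul_forecast_le hω hl hβ hγ hT hN j₀ hFc hFs hs
  calc ∫⁻ s in Ioi (0 : ℝ), ENNReal.ofReal ((∫ x, (x.2 j₀ ^ 2 - T) * U s x ∂μ) ^ 2)
      ≤ ENNReal.ofReal (T ^ 3) * X := hpw
    _ = ENNReal.ofReal (T ^ 2 / (2 * γ)) * (ENNReal.ofReal (2 * γ * T) * X) := by
        rw [← mul_assoc, ← ENNReal.ofReal_mul (by positivity)]
        congr 2
        rw [div_mul_eq_mul_div, eq_div_iff (by positivity)]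
        ring
    _ ≤ ENNReal.ofReal (T ^ 2 / (2 * γ)) * ENNReal.ofReal (∫ x, F x ^ 2 ∂μ) := by gcongr
    _ = ENNReal.ofReal (T ^ 2 / (2 * γ) * ∫ x, F x ^ 2 ∂μ) := by rw [← ENNReal.ofReal_mul (by positivity)]

end KinPointwise

/-! ## 9. `∫_{t>0} C_N(t)² dt ≤ T⁴/γ` for every `N` -/

section ItemKin

open Summit.AtomisticToContinuum.FouriersLaw.Theorems.SubdiffusiveBondHeat

variable {ω₂ lam β γ : ℝ} (hω : 0 < ω₂) (hl : 0 ≤ lam) (hβ : 0 < β) (hγ : 0 < γ) {T : ℝ} (hT : 0 < T)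
include hω hl hβ hγ hT

omit hβ hγ hT in
/-- `|p_i² - T| ≤ 9T e^{H/(4T)}` for the pinned chain (`p_i² ≤ 8T e^{H/(4T)}`, `1 ≤ e^{H/(4T)}`). [folklore] -/
theorem abs_sq_momentum_sub_le_exp (hβ' : 0 ≤ β) (hT' : 0 < T) {n : ℕ} (z : PhaseSpace n) (i : Fin n) :
    |z.2 i ^ 2 - T| ≤ 9 * T * Real.exp (1 / (4 * T) * (pinnedChain ω₂ lam β γ).hamiltonian n z) := by
  have hϑ0 : (0 : ℝ) < 1 / (4 * T) := by positivity
  have hsq := sq_momentum_le_exp (γ := γ) hω hl hβ' hϑ0 z i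
  have hE1 : 1 ≤ Real.exp (1 / (4 * T) * (pinnedChain ω₂ lam β γ).hamiltonian n z) :=
    Real.one_le_exp (mul_nonneg hϑ0.le (pinnedChain_hamiltonian_nonneg hω.le hl hβ' γ n z))
  have h8 : 2 / (1 / (4 * T)) = 8 * T := by field_simp; ring
  rw [h8] at hsq
  calc |z.2 i ^ 2 - T| ≤ |z.2 i ^ 2| + |T| := abs_sub _ _
    _ = z.2 i ^ 2 + T := by rw [abs_of_nonneg (sq_nonneg _), abs_of_pos hT']
    _ ≤ 8 * T * Real.exp (1 / (4 * T) * (pinnedChain ω₂ lam β γ).hamiltonian n z) +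
        T * Real.exp (1 / (4 * T) * (pinnedChain ω₂ lam β γ).hamiltonian n z) := by nlinarith
    _ = 9 * T * Real.exp (1 / (4 * T) * (pinnedChain ω₂ lam β γ).hamiltonian n z) := by ring

/-- **The `N`-uniform `L²(dt)` bound on the power covariance, lower-integral form.** For every `N`,

  `∫_{t>0} C_N(t)² dt ≤ T⁴/γ`,  `C_N(t) = ∫ p₀² (K_t p_N²) dμ₀ - (∫ p₀² dμ₀)(∫ K_t p_N² dμ₀)`:

`C_N(t) = ∫ (p₀² - T) K_t(p_N² - T) dμ₀` (`CN_eq_kinCorr`); truncate `p_N² - T` to `F_k = χ_k (p_N² - T) ∈ C_c`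
(`∫ F_k² dμ₀ ≤ Var_{μ₀}(p_N²) = 2T²`), apply `lintegral_sq_integral_kin_mul_forecast_le`, pass to the limit by
dominated convergence (twice) and conclude by Fatou's lemma in `t`. [folklore] -/
theorem lintegral_CN_sq_le (N : ℕ) :
    ∫⁻ t in Ioi (0 : ℝ), ENNReal.ofReal (((∫ z, (z.2 0) ^ 2 * (∫ y, (y.2 (Fin.last N)) ^ 2
        ∂((pinnedChain ω₂ lam β γ).transitionKernel (N + 1) T T t.toNNReal z))
          ∂((pinnedChain ω₂ lam β γ).gibbsMeasure (N + 1) T)) -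
        (∫ z, (z.2 0) ^ 2 ∂((pinnedChain ω₂ lam β γ).gibbsMeasure (N + 1) T)) *
        (∫ z, (∫ y, (y.2 (Fin.last N)) ^ 2 ∂((pinnedChain ω₂ lam β γ).transitionKernel (N + 1) T T t.toNNReal z))
          ∂((pinnedChain ω₂ lam β γ).gibbsMeasure (N + 1) T))) ^ 2) ≤
      ENNReal.ofReal (T ^ 4 / γ) := by
  -- rewrite `C_N` as the cross-correlation of the two kinetic observables
  have hCN := CN_eq_kinCorr hω hl hβ hγ hT N
  simp_rw [hCN]
  set P := pinnedChain ω₂ lam β γ with hP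
  set μ := P.gibbsMeasure (N + 1) T with hμ
  haveI : IsProbabilityMeasure μ := pinnedChain_isProbabilityMeasure_gibbsMeasure hω hl hβ.le γ (N + 1) hT
  haveI hMK : ∀ t, IsMarkovKernel (P.transitionKernel (N + 1) T T t) := fun t =>
    pinnedChain_isMarkovKernel_transitionKernel hω hl hβ.le hγ.le (N + 1) T T t
  have hNp : 0 < N + 1 := Nat.succ_pos N
  -- the truncations `F_k = χ_k · (p_N² - T)`
  set gL : PhaseSpace (N + 1) → ℝ := fun y => y.2 (Fin.last N) ^ 2 - T with hgL
  have hgLc : Continuous gL := by fun_prop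
  set χ : ℕ → ContDiffBump (0 : PhaseSpace (N + 1)) := fun k =>
    ⟨(k : ℝ) + 1, (k : ℝ) + 2, by positivity, by linarith⟩ with hχ
  set Fk : ℕ → PhaseSpace (N + 1) → ℝ := fun k y => (χ k) y * gL y with hFk
  have hFkc : ∀ k, Continuous (Fk k) := fun k => (χ k).continuous.mul hgLc
  have hFks : ∀ k, HasCompactSupport (Fk k) := fun k => (χ k).hasCompactSupport.mul_right
  have hFk_le : ∀ k y, |Fk k y| ≤ |gL y| := fun k y => by
    rw [hFk]; dsimp only; rw [abs_mul, abs_of_nonneg (χ k).nonneg]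
    exact mul_le_of_le_one_left (abs_nonneg _) (χ k).le_one
  have hFk_lim : ∀ y, Tendsto (fun k => Fk k y) atTop (𝓝 (gL y)) := by
    intro y
    refine tendsto_const_nhds.congr' ?_
    obtain ⟨k₀, hk₀⟩ := exists_nat_ge ‖y‖
    filter_upwards [eventually_ge_atTop k₀] with k hk
    rw [hFk]; dsimp only
    rw [(χ k).one_of_mem_closedBall, one_mul]
    rw [Metric.mem_closedBall, dist_zero_right]
    calc ‖y‖ ≤ k₀ := hk₀
      _ ≤ k := by exact_mod_cast hk
      _ ≤ (k : ℝ) + 1 := by linarith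
  -- `∫ F_k² dμ₀ ≤ ∫ (p_N² - T)² dμ₀ = 2T²`
  have hϑ0 : (0 : ℝ) < 1 / (4 * T) := by positivity
  have hϑ1 : 1 / (4 * T) < 1 / T := by
    rw [div_lt_div_iff₀ (by positivity) hT]; nlinarith
  have h2ϑ : 2 * (1 / (4 * T)) < 1 / T := by
    rw [show 2 * (1 / (4 * T)) = 1 / (2 * T) by field_simp; ring, div_lt_div_iff₀ (by positivity) hT]; nlinarith
  have hgLexp : ∀ y, |gL y| ≤ 9 * T * Real.exp (1 / (4 * T) * P.hamiltonian (N + 1) y) := fun y =>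
    abs_sq_momentum_sub_le_exp hω hl hβ.le hT y (Fin.last N)
  obtain ⟨hgL2, -, -⟩ := pinnedChain_integral_sq_act_le hω hl hβ hγ hNp hT hϑ0 h2ϑ hgLc hgLexp 0
  have hvar : ∫ y, gL y ^ 2 ∂μ = 2 * T ^ 2 := by
    have hexpμ := pinnedChain_integrable_exp_mul_hamiltonian_gibbsMeasure hω hl hβ.le γ (N + 1) hT hϑ1
    have i2 : Integrable (fun y : PhaseSpace (N + 1) => y.2 (Fin.last N) ^ 2) μ :=
      integrable_of_abs_le_exp hexpμ (by fun_prop) (fun y => by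
        rw [abs_of_nonneg (sq_nonneg _)]
        exact sq_momentum_le_exp (γ := γ) hω hl hβ.le hϑ0 y (Fin.last N))
    have i4 : Integrable (fun y : PhaseSpace (N + 1) => y.2 (Fin.last N) ^ 4) μ := by
      have h := hgL2.add ((i2.const_mul (2 * T)).sub (integrable_const (T ^ 2)))
      refine h.congr (ae_of_all _ fun y => ?_)
      simp only [hgL, Pi.add_apply, Pi.sub_apply]
      ring
    have hsplit : (fun y => gL y ^ 2) = fun y : PhaseSpace (N + 1) =>
        y.2 (Fin.last N) ^ 4 - 2 * T * y.2 (Fin.last N) ^ 2 + T ^ 2 := by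
      funext y; rw [hgL]; ring
    have i42 : Integrable (fun y : PhaseSpace (N + 1) => y.2 (Fin.last N) ^ 4 - 2 * T * y.2 (Fin.last N) ^ 2) μ :=
      i4.sub (i2.const_mul _)
    rw [hsplit, integral_add i42 (integrable_const _), integral_sub i4 (i2.const_mul _),
      integral_const_mul, integral_const, probReal_univ, one_smul,
      integral_momentum_pow_four_gibbsMeasure hω hl hβ hT (N + 1) (Fin.last N),
      integral_momentum_sq_gibbsMeasure (γ := γ) hω hl hβ hT (N + 1) (Fin.last N)]
    ring
  have hFk2 : ∀ k, ∫ y, Fk k y ^ 2 ∂μ ≤ 2 * T ^ 2 := by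
    intro k
    rw [← hvar]
    refine integral_mono_of_nonneg (ae_of_all _ fun y => sq_nonneg _) hgL2 (ae_of_all _ fun y => ?_)
    show Fk k y ^ 2 ≤ gL y ^ 2
    exact (sq_le_sq' (abs_le.1 (hFk_le k y)).1 (abs_le.1 (hFk_le k y)).2).trans (le_of_eq (sq_abs _))
  -- the approximating correlations and their limit
  set f0 : PhaseSpace (N + 1) → ℝ := fun z => z.2 0 ^ 2 - T with hf0
  have hf0c : Continuous f0 := by fun_prop
  have hf0exp : ∀ y, |f0 y| ≤ 9 * T * Real.exp (1 / (4 * T) * P.hamiltonian (N + 1) y) := fun y =>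
    abs_sq_momentum_sub_le_exp hω hl hβ.le hT y 0
  set ck : ℕ → ℝ → ℝ := fun k t => ∫ z, f0 z *
    (∫ y, Fk k y ∂(P.transitionKernel (N + 1) T T t.toNNReal z)) ∂μ with hck
  set c : ℝ → ℝ := fun t => ∫ z, f0 z * (∫ y, gL y ∂(P.transitionKernel (N + 1) T T t.toNNReal z)) ∂μ with hc
  show ∫⁻ t in Ioi (0 : ℝ), ENNReal.ofReal (c t ^ 2) ≤ ENNReal.ofReal (T ^ 4 / γ)
  have hck_bound : ∀ k, ∫⁻ t in Ioi (0 : ℝ), ENNReal.ofReal (ck k t ^ 2) ≤ ENNReal.ofReal (T ^ 4 / γ) := by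
    intro k
    refine (lintegral_sq_integral_kin_mul_forecast_le hω hl hβ hγ hNp hT (hFkc k) (hFks k)).trans ?_
    refine ENNReal.ofReal_le_ofReal ?_
    calc T ^ 2 / (2 * γ) * ∫ x, Fk k x ^ 2 ∂μ ≤ T ^ 2 / (2 * γ) * (2 * T ^ 2) :=
          mul_le_mul_of_nonneg_left (hFk2 k) (by positivity)
      _ = T ^ 4 / γ := by rw [div_mul_eq_mul_div, div_eq_div_iff (by positivity) (by positivity)]; ring
  have hck_meas : ∀ k, Measurable (ck k) := fun k => measurable_corr hω hl hβ hγ hT hf0c (hFkc k)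
  -- dominated convergence inside the kernels
  have hbdK : ∀ (t : ℝ) (z : PhaseSpace (N + 1)), Integrable (fun y => |gL y|) (P.transitionKernel (N + 1) T T t.toNNReal z) :=
    fun t z => integrable_of_abs_le_exp
      (pinnedChain_integrable_exp_mul_hamiltonian_transitionKernel hω hl hT hβ.le hγ.le hNp hϑ0 hϑ1 t.toNNReal z)
      (by fun_prop) (fun y => by rw [abs_abs]; exact hgLexp y)
  have hin : ∀ (t : ℝ) (z : PhaseSpace (N + 1)),
      Tendsto (fun k => ∫ y, Fk k y ∂(P.transitionKernel (N + 1) T T t.toNNReal z)) atTop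
        (𝓝 (∫ y, gL y ∂(P.transitionKernel (N + 1) T T t.toNNReal z))) := fun t z =>
    tendsto_integral_of_dominated_convergence (fun y => |gL y|)
      (fun k => (hFkc k).aestronglyMeasurable) (hbdK t z)
      (fun k => ae_of_all _ fun y => by rw [Real.norm_eq_abs]; exact hFk_le k y)
      (ae_of_all _ fun y => hFk_lim y)
  -- dominated convergence under `μ₀`
  have hout : ∀ t : ℝ, Tendsto (fun k => ck k t) atTop (𝓝 (c t)) := by
    intro t
    have hdom : Integrable (fun z : PhaseSpace (N + 1) => |f0 z| *
        ∫ y, |gL y| ∂(P.transitionKernel (N + 1) T T t.toNNReal z)) μ :=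
      integrable_mul_act hω hl hβ hγ hT (f := fun z => |f0 z|) (g := fun y => |gL y|)
        (by fun_prop) (by fun_prop)
        (fun y => by rw [abs_abs]; exact hf0exp y) (fun y => by rw [abs_abs]; exact hgLexp y) t.toNNReal
    refine tendsto_integral_of_dominated_convergence
      (fun z : PhaseSpace (N + 1) => |f0 z| * ∫ y, |gL y| ∂(P.transitionKernel (N + 1) T T t.toNNReal z))
      (fun k => ?_) hdom (fun k => ae_of_all _ fun z => ?_) (ae_of_all _ fun z => (hin t z).const_mul (f0 z))
    · exact hf0c.aestronglyMeasurable.mul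
        ((hFkc k).stronglyMeasurable.integral_kernel
          (κ := P.transitionKernel (N + 1) T T t.toNNReal)).aestronglyMeasurable
    · rw [Real.norm_eq_abs, abs_mul]
      refine mul_le_mul_of_nonneg_left ?_ (abs_nonneg _)
      calc |∫ y, Fk k y ∂(P.transitionKernel (N + 1) T T t.toNNReal z)|
          ≤ ∫ y, |Fk k y| ∂(P.transitionKernel (N + 1) T T t.toNNReal z) := abs_integral_le_integral_abs
        _ ≤ ∫ y, |gL y| ∂(P.transitionKernel (N + 1) T T t.toNNReal z) :=
          integral_mono_of_nonneg (ae_of_all _ fun y => abs_nonneg _) (hbdK t z)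
            (ae_of_all _ fun y => hFk_le k y)
  -- Fatou in `t`
  have hlim : ∀ t, liminf (fun k => ENNReal.ofReal (ck k t ^ 2)) atTop = ENNReal.ofReal (c t ^ 2) := fun t =>
    (ENNReal.tendsto_ofReal ((hout t).pow 2)).liminf_eq
  calc ∫⁻ t in Ioi (0 : ℝ), ENNReal.ofReal (c t ^ 2)
      = ∫⁻ t in Ioi (0 : ℝ), liminf (fun k => ENNReal.ofReal (ck k t ^ 2)) atTop :=
        lintegral_congr fun t => (hlim t).symm
    _ ≤ liminf (fun k => ∫⁻ t in Ioi (0 : ℝ), ENNReal.ofReal (ck k t ^ 2)) atTop :=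
        lintegral_liminf_le fun k => ((hck_meas k).pow_const 2).ennreal_ofReal
    _ ≤ ENNReal.ofReal (T ^ 4 / γ) :=
        liminf_le_of_frequently_le' (Frequently.of_forall fun k => hck_bound k)

/-- `t ↦ C_N(t)²` is integrable on `(0, ∞)` at each fixed `N` (`C_N² ≤ C² e^{-2ct}`, `CN_exp_decay`). [folklore] -/
theorem CN_sq_integrableOn (N : ℕ) :
    IntegrableOn (fun t : ℝ => ((∫ z, (z.2 0) ^ 2 * (∫ y, (y.2 (Fin.last N)) ^ 2
        ∂((pinnedChain ω₂ lam β γ).transitionKernel (N + 1) T T t.toNNReal z))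
          ∂((pinnedChain ω₂ lam β γ).gibbsMeasure (N + 1) T)) -
        (∫ z, (z.2 0) ^ 2 ∂((pinnedChain ω₂ lam β γ).gibbsMeasure (N + 1) T)) *
        (∫ z, (∫ y, (y.2 (Fin.last N)) ^ 2 ∂((pinnedChain ω₂ lam β γ).transitionKernel (N + 1) T T t.toNNReal z))
          ∂((pinnedChain ω₂ lam β γ).gibbsMeasure (N + 1) T))) ^ 2) (Set.Ioi 0) := by
  obtain ⟨C, c, hc, hb⟩ := CN_exp_decay hω hl hβ hγ hT N
  refine Integrable.mono' ((exp_neg_integrableOn_Ioi 0 (by positivity : 0 < 2 * c)).const_mul (C ^ 2))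
    ((measurable_CN hω hl hβ hγ hT N).pow_const 2).aestronglyMeasurable ?_
  refine (ae_restrict_iff' measurableSet_Ioi).2 (Eventually.of_forall fun t ht => ?_)
  rw [Real.norm_eq_abs, abs_pow, show C ^ 2 * Real.exp (-(2 * c) * t) = (C * Real.exp (-c * t)) ^ 2 by
    rw [mul_pow, ← Real.exp_nat_mul]; ring_nf]
  exact pow_le_pow_left₀ (abs_nonneg _) (hb t (le_of_lt ht)) 2

/-- **The `N`-uniform `L²(dt)` bound on the power covariance of the item**: for every `N`,

  `∫_{t>0} C_N(t)² dt ≤ T⁴/γ`.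

Together with `integral_rN_sq_le` these are the `N`-uniform a-priori estimates the equilibrium dissipation
method yields on the two channels of `a_N`; both are `O(1)`, whereas `a_N = O(1)` needs the signed time integral
`∫_{t>0} C_N = O(1/N)` (the conductance upper bound, open). [folklore] -/
theorem integral_CN_sq_le (N : ℕ) :
    ∫ t in Ioi (0 : ℝ), ((∫ z, (z.2 0) ^ 2 * (∫ y, (y.2 (Fin.last N)) ^ 2
        ∂((pinnedChain ω₂ lam β γ).transitionKernel (N + 1) T T t.toNNReal z))
          ∂((pinnedChain ω₂ lam β γ).gibbsMeasure (N + 1) T)) -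
        (∫ z, (z.2 0) ^ 2 ∂((pinnedChain ω₂ lam β γ).gibbsMeasure (N + 1) T)) *
        (∫ z, (∫ y, (y.2 (Fin.last N)) ^ 2 ∂((pinnedChain ω₂ lam β γ).transitionKernel (N + 1) T T t.toNNReal z))
          ∂((pinnedChain ω₂ lam β γ).gibbsMeasure (N + 1) T))) ^ 2 ≤ T ^ 4 / γ := by
  have hi := CN_sq_integrableOn hω hl hβ hγ hT N
  rw [integral_eq_lintegral_of_nonneg_ae (ae_of_all _ fun t => sq_nonneg _) hi.aestronglyMeasurable]
  exact ENNReal.toReal_le_of_le_ofReal (by positivity) (lintegral_CN_sq_le hω hl hβ hγ hT N)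

end ItemKin

end Summit.AtomisticToContinuum.FouriersLaw.Theorems.IncoherentBounded
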